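import Mathlib.Probability.Distributions.Gaussian.IsGaussianProcess.Basic
import Mathlib.Analysis.SpecialFunctions.Exp
import Literature.Probability.LatticeModels.LatticeGreenFunction
import Literature.Probability.LatticeModels.ProdBernoulliCoupling
import Literature.Probability.Percolation.PercolationEvents
import Literature.Probability.Percolation.PercolationProofs
import HarnessLib

/-!
# Level-set percolation of the Gaussian free field on the cable system of `ℤ^d`, `d ≥ 3`
# (Lupu 2016; Drewitz–Prévost–Rodriguez 2018, 2022) — the vertex trace

Topic `Literature/Probability/LatticeModels`; fact request `wi-16511` and definition requests D1
(`IsDiscreteGFF`), D2 (`lupuWeight`) of route CriticalPhenomena/PercolationContinuityZ3/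
PercLupuEnvironment (support item `SolvedEndAnchor` (i), (ii)).

## The mathematics and its sources (numbering of the arXiv versions)

Let `d ≥ 3` and let `φ = (φ_x)_{x ∈ ℤ^d}` be the DISCRETE GAUSSIAN FREE FIELD of `ℤ^d` with unit
conductances: the centred Gaussian process with `E[φ_x φ_y] = G(x,y)`, `G = (-L)⁻¹` the Green
function of the jump process with rate `1` along each edge, `L f(x) = ∑_{y ∼ x} (f(y) - f(x))`
[Lupu 2016 = arXiv:1402.0298, §1; DPR 2018 = arXiv:1708.03285, (1.1)–(1.2)]; in the tree's
normalisation `G(x,y) = latticeGreen (x - y) / 2` (`LatticeGreenFunction.lean`: `latticeGreen` has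
Fourier symbol `1/ε(p)`, `ε(p) = ∑ᵢ (1 - cos pᵢ)`, i.e. it is twice `(-L)⁻¹`, whose symbol is
`1/(2ε)`).  The CABLE SYSTEM `ℤ̃^d` glues a segment `I_e` of length `1/2` in place of every edge
`e`; the GFF `φ̃` on `ℤ̃^d` restricts to `φ` on `ℤ^d`, and CONDITIONALLY ON `φ` its values on the
edges are independent Brownian bridges of length `1/2` (variance `2` at time `1`) between the
endpoint values [DPR 2018, (2.6)–(2.8); Lupu 2016, §2], so that by the reflection formula for the
bridge [DPR 2018, Lemma 2.1: `P(sup B > M) = exp(-2(M-x)(M-y)/(lσ²))`, here `lσ² = 1`], for every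
level `-h` and every edge `e = {x,y}`, conditionally on `φ` and independently over the edges,

  `P(φ̃ > -h on the whole closed segment Ī_e | φ) = 𝟙[φ_x + h > 0, φ_y + h > 0] ·
      (1 - exp(-2 (φ_x + h)(φ_y + h)))`                                                    (★)

(at `h = 0` this is Lupu's coupling formula `1 - exp(-2 C(x,y) φ_x φ_y)` on `{φ_x φ_y > 0}`
[Lupu 2016, Cor. 3.6, Lemma 4.1 (4.2), Prop. 4.2]).  Consequently the VERTEX TRACE of the
excursion set `{φ̃ > -h}` — the bond configuration `ω^h` on `ℤ^d` with `e` open iff `φ̃ > -h` on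
`Ī_e` — is, conditionally on `φ`, the inhomogeneous Bernoulli bond percolation `prodBernoulli
(lupuWeight (h + φ))` with the LUPU WEIGHTS `lupuWeight ψ {x,y} = 1 - exp(-2 ψ_x⁺ ψ_y⁺)`; an
excursion-set component of `φ̃` is unbounded iff its vertex trace is an infinite `ω^h`-cluster
(`ℤ^d` is locally finite and every cable is compact), and `{φ̃ ≥ -h}` and `{φ̃ > -h}` have the same
unbounded components a.s. (the minimum of a bridge and the values `φ_x` are atomless).  In these
terms the two printed theorems about `φ̃` on `ℤ̃^d`, `d ≥ 3`, read:

* BOUNDED SIGN CLUSTERS AT LEVEL `0` [Lupu 2016, Prop. 5.5: "With probability one `𝒞'` (the trace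
  on the vertices and edges of `ℤ^d` of the sign clusters of `φ̃`) has only finite clusters";
  DPR 2018, (1.11): "`{φ̃ ≥ 0}` does not contain unbounded clusters"; DPR 2022 = arXiv:2101.05800,
  Cor. 1.2]: for every vertex `x`, almost surely the `ω^0`-cluster of `x` is finite, i.e. for
  a.e. realisation of `φ` the quenched probability `prodBernoulli (lupuWeight φ) {|C(x)| = ∞}`
  vanishes — `Lupu2016_cableSignClustersBounded`.
* PERCOLATION STRICTLY BELOW LEVEL `0`, `h̃_* = 0` [DPR 2022, Cor. 3.3 (2) (transient weighted
  graph, no killing): "for each `h < 0` the level set `E^{≥h}(x₀)` of `x₀` is unbounded with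
  positive probability"; DPR 2018, (1.10); Lupu 2016, proof of Thm 3, p. 20]: for every `h > 0` and
  every vertex `x`,
  `P(x ∈ an infinite ω^h-cluster) = E[prodBernoulli (lupuWeight (h + φ)) {|C(x)| = ∞}] > 0`
  — `Lupu2016_cableLevelSetsPercolate`.

## Lean rendering

* `IsDiscreteGFF P g` (D1): `g : Site d → Ω → ℝ` is a Gaussian process (Mathlib
  `ProbabilityTheory.IsGaussianProcess`), centred, with `∫ g x * g y ∂P = latticeGreen (x - y) / 2`
  — exactly the three hypotheses the route's items carry inline.
* `lupuWeight ψ : Sym2 (Site d) → unitInterval` (D2): `1 - exp(-2 ψ_x⁺ ψ_y⁺)` on the edges of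
  `zdGraph d`, `0` off them — literally the route's `let W := …` prefix (`lupuWeight_def` is
  `rfl`), with the API `coe_lupuWeight_of_adj`, `lupuWeight_of_not_mem`,
  `lupuWeight_eq_zero_of_nonpos`, `lupuWeight_mono_of_posPart_le` / `lupuWeight_mono` /
  `lupuWeight_le_smul_add` (monotone along the route's rays `ψ ↦ cψ + t`, `c ≥ 1`, `t ≥ 0`).
* The facts quantify over ALL versions `(Ω, P, g)` of the GFF with `Ω : Type` (as the route does);
  they are statements about the joint law of `(φ, ω^h)`, which `prodBernoulli ∘ lupuWeight` builds
  measurably from `φ`.  Fact A is stated in the informative almost-sure form (no integrability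
  side issue); the route's annealed form `∫ … = 0` is the proved corollary
  `Lupu2016_cableSignClustersBounded.integral_eq_zero`.  Fact B is DPR 2022 Cor. 3.3 (2) verbatim
  (one-point function positive), written with the route's annealed integral.

## What is NOT here

* The cable system `ℤ̃^d`, its Brownian motion and the field `φ̃` as Lean objects, hence the
  coupling formula (★) as a Lean theorem (it is the dictionary justifying the rendering, cited
  above); Lupu's isomorphism with loop soups / interlacements (Thm 1, Thm 3), `h_* ≤ √(2u_*)`.
* Uniqueness in law / existence of the discrete GFF (route item `GFFExists`), translation
  invariance and ergodicity of the annealed model, the one-arm decay `n^{-1/2}` on `ℤ³`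
  (Drewitz–Prévost–Rodriguez 2025, route item (iii)) — separate requests.
-/

noncomputable section

namespace Literature.Probability.LatticeModels

open _root_.MeasureTheory _root_.ProbabilityTheory Literature.Probability.Percolation

variable {d : ℕ}

/-! ### D2: the Lupu weights -/

/-- The LUPU WEIGHT of the bond `e = {x, y}` of `ℤ^d` in the field `ψ`:
`1 - exp(-2 ψ_x⁺ ψ_y⁺) ∈ [0, 1]` on edges of `zdGraph d` and `0` on non-edges — conditionally on the
discrete Gaussian free field `φ`, the probability that the cable-system field `φ̃` stays positive
on the whole cable `Ī_e` (unit conductances, cables of length `1/2`), i.e. Lupu's coupling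
probability `𝟙[φ_x φ_y > 0](1 - e^{-2 C(x,y) φ_x φ_y})` restricted to the positive side; with
`ψ = h + φ` it is the conditional probability that `φ̃ > -h` on `Ī_e` (reflection formula for the
Brownian bridge of length `1/2` and variance `2`, Drewitz–Prévost–Rodriguez 2018 Lemma 2.1 and
(2.8)).  Written with `Set.projIcc` and `Sym2.mul ∘ Sym2.map` exactly as in the items of route
PercLupuEnvironment (`lupuWeight_def`).
[cite: Lupu2016, Cor. 3.6 and Prop. 4.2 (arXiv numbering)] -/
def lupuWeight (ψ : Site d → ℝ) : Sym2 (Site d) → unitInterval :=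
  fun e => if e ∈ (zdGraph d).edgeSet then
    Set.projIcc (0 : ℝ) 1 zero_le_one (1 - Real.exp (-2 * (e.map fun x => max (ψ x) 0).mul)) else 0

/-- Unfolding `lupuWeight` (the route's inline `let W := …`, definitionally).
[cite: Lupu2016, Cor. 3.6 (arXiv numbering)] -/
theorem lupuWeight_def (ψ : Site d → ℝ) :
    lupuWeight ψ = fun e => if e ∈ (zdGraph d).edgeSet then
      Set.projIcc (0 : ℝ) 1 zero_le_one (1 - Real.exp (-2 * (e.map fun x => max (ψ x) 0).mul))
      else 0 :=
  rfl

/-- Non-edges carry weight `0` (they are never open).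
[cite: Lupu2016, Cor. 3.6 (arXiv numbering)] -/
theorem lupuWeight_of_not_mem (ψ : Site d → ℝ) {e : Sym2 (Site d)}
    (he : e ∉ (zdGraph d).edgeSet) : lupuWeight ψ e = 0 := by
  simp only [lupuWeight, he, if_false]

/-- The real number `1 - exp(-2ab)` lies in `[0, 1]` for `a, b ≥ 0`. [folklore] -/
theorem one_sub_exp_mem_Icc {a b : ℝ} (ha : 0 ≤ a) (hb : 0 ≤ b) :
    1 - Real.exp (-2 * (a * b)) ∈ Set.Icc (0 : ℝ) 1 := by
  constructor
  · have : Real.exp (-2 * (a * b)) ≤ 1 :=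
      Real.exp_le_one_iff.2 (by nlinarith [mul_nonneg ha hb])
    linarith
  · linarith [Real.exp_pos (-2 * (a * b))]

/-- On an edge `{x, y}` of `ℤ^d` the Lupu weight is `1 - exp(-2 ψ_x⁺ ψ_y⁺)`.
[cite: Lupu2016, Cor. 3.6 (arXiv numbering)] -/
theorem coe_lupuWeight_of_adj (ψ : Site d → ℝ) {x y : Site d} (h : (zdGraph d).Adj x y) :
    (lupuWeight ψ s(x, y) : ℝ) = 1 - Real.exp (-2 * (max (ψ x) 0 * max (ψ y) 0)) := by
  have he : s(x, y) ∈ (zdGraph d).edgeSet := (SimpleGraph.mem_edgeSet _).2 h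
  simp only [lupuWeight, he, if_true, Sym2.map_mk, Sym2.mul_mk]
  rw [Set.projIcc_of_mem _ (one_sub_exp_mem_Icc (le_max_right _ _) (le_max_right _ _))]

/-- A bond at a vertex where the field is `≤ 0` is closed: its Lupu weight vanishes (only the
POSITIVE excursion set is traced). [cite: Lupu2016, Cor. 3.6 (arXiv numbering)] -/
theorem lupuWeight_eq_zero_of_nonpos (ψ : Site d → ℝ) {x : Site d} (hx : ψ x ≤ 0) (y : Site d) :
    lupuWeight ψ s(x, y) = 0 := by
  by_cases he : s(x, y) ∈ (zdGraph d).edgeSet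
  · apply Subtype.ext
    rw [coe_lupuWeight_of_adj ψ ((SimpleGraph.mem_edgeSet _).1 he), max_eq_right hx]
    simp
  · exact lupuWeight_of_not_mem ψ he

/-- The Lupu weights depend on the field only through its positive part, monotonically: if
`ψ⁺ ≤ ψ'⁺` pointwise then `lupuWeight ψ ≤ lupuWeight ψ'` (e.g. `ψ' = c ψ + t` with `c ≥ 1`,
`t ≥ 0`, the rays of route PercLupuEnvironment). [cite: Lupu2016, Cor. 3.6 (arXiv numbering)] -/
theorem lupuWeight_mono_of_posPart_le {ψ ψ' : Site d → ℝ} (h : ∀ x, max (ψ x) 0 ≤ max (ψ' x) 0) :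
    lupuWeight ψ ≤ lupuWeight ψ' := by
  intro e
  induction e using Sym2.ind with
  | _ x y =>
    by_cases he : s(x, y) ∈ (zdGraph d).edgeSet
    · have hadj := (SimpleGraph.mem_edgeSet _).1 he
      change (lupuWeight ψ s(x, y) : ℝ) ≤ lupuWeight ψ' s(x, y)
      rw [coe_lupuWeight_of_adj ψ hadj, coe_lupuWeight_of_adj ψ' hadj]
      have hprod : max (ψ x) 0 * max (ψ y) 0 ≤ max (ψ' x) 0 * max (ψ' y) 0 :=
        mul_le_mul (h x) (h y) (le_max_right _ _) ((le_max_right _ _).trans (h x))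
      have := Real.exp_le_exp.2 (show -2 * (max (ψ' x) 0 * max (ψ' y) 0) ≤
        -2 * (max (ψ x) 0 * max (ψ y) 0) by linarith)
      linarith
    · rw [lupuWeight_of_not_mem ψ he, lupuWeight_of_not_mem ψ' he]

/-- The Lupu weights are monotone in the field (pointwise), the source of the stochastic
monotonicity of the level-set family in the level. [cite: Lupu2016, Cor. 3.6 (arXiv numbering)] -/
theorem lupuWeight_mono {ψ ψ' : Site d → ℝ} (h : ψ ≤ ψ') : lupuWeight ψ ≤ lupuWeight ψ' :=
  lupuWeight_mono_of_posPart_le fun x => max_le_max (h x) le_rfl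

/-- Along the rays `ψ ↦ c ψ + t`, `c ≥ 1`, `t ≥ 0`, the Lupu weights increase (`(cψ + t)⁺ ≥ ψ⁺`).
[cite: Lupu2016, Cor. 3.6 (arXiv numbering)] -/
theorem lupuWeight_le_smul_add (ψ : Site d → ℝ) {c t : ℝ} (hc : 1 ≤ c) (ht : 0 ≤ t) :
    lupuWeight ψ ≤ lupuWeight fun x => c * ψ x + t := by
  refine lupuWeight_mono_of_posPart_le fun x => max_le ?_ (le_max_right _ _)
  rcases le_or_gt 0 (ψ x) with hx | hx
  · exact le_max_of_le_left (by nlinarith)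
  · exact (le_of_lt hx).trans (le_max_right _ _)

/-! ### D1: the discrete Gaussian free field of `ℤ^d` -/

/-- `g` is (a version of) the DISCRETE GAUSSIAN FREE FIELD of `ℤ^d` with unit conductances under
`P`: a Gaussian process (all finite-dimensional marginals Gaussian), centred, with covariance the
Green function `G(x,y) = (-L)⁻¹(x,y) = latticeGreen (x - y) / 2` of the nearest-neighbour jump
process with unit rates (`L f(x) = ∑_{y ∼ x}(f(y) - f(x))`; meaningful for `d ≥ 3`, where
`latticeGreen` is a convergent integral).  Exactly the three hypotheses carried by the items of
route PercLupuEnvironment. [cite: Lupu2016, §1 (arXiv numbering)] -/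
def IsDiscreteGFF {Ω : Type*} [MeasurableSpace Ω] (P : Measure Ω) (g : Site d → Ω → ℝ) : Prop :=
  IsGaussianProcess g P ∧ (∀ x, ∫ ω, g x ω ∂P = 0) ∧
    ∀ x y, ∫ ω, g x ω * g y ω ∂P = latticeGreen (x - y) / 2

/-- Unfolding `IsDiscreteGFF`. [cite: Lupu2016, §1 (arXiv numbering)] -/
theorem isDiscreteGFF_iff {Ω : Type*} [MeasurableSpace Ω] (P : Measure Ω) (g : Site d → Ω → ℝ) :
    IsDiscreteGFF P g ↔ IsGaussianProcess g P ∧ (∀ x, ∫ ω, g x ω ∂P = 0) ∧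
      ∀ x y, ∫ ω, g x ω * g y ω ∂P = latticeGreen (x - y) / 2 :=
  Iff.rfl

/-! ### Fact A: bounded sign clusters on the cable system (level `0`) -/

/-- **Lupu 2016, Prop. 5.5 (vertex trace); = Drewitz–Prévost–Rodriguez 2018 (1.11), 2022
Cor. 1.2.**  For `d ≥ 3`, the Gaussian free field `φ̃` on the cable system `ℤ̃^d` (unit
conductances) has almost surely only BOUNDED sign clusters; equivalently (conditioning on the
discrete field `φ = φ̃|_{ℤ^d}`, given which the cables free of zeros of `φ̃` on the positive side
are independent with probabilities `lupuWeight φ`, Lupu's coupling Cor. 3.6 / Prop. 4.2 and DPR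
2018 Lemma 2.1, (2.8)): for every version `g` of the discrete GFF and every vertex `x`, for
`P`-almost every realisation the inhomogeneous Bernoulli bond percolation with the Lupu weights of
`g(ω)` has `|C(x)| < ∞` almost surely.  (The negative sign clusters are covered by applying the
statement to the GFF `-g`.)  The route's annealed form is the corollary
`Lupu2016_cableSignClustersBounded.integral_eq_zero`.
[cite: Lupu2016, Prop. 5.5 (arXiv numbering)] -/
def Lupu2016_cableSignClustersBounded : Prop :=
  ∀ (d : ℕ), 3 ≤ d → ∀ (Ω : Type) [MeasurableSpace Ω] (P : Measure Ω) [IsProbabilityMeasure P]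
    (g : Site d → Ω → ℝ), IsDiscreteGFF P g →
    ∀ x : Site d, ∀ᵐ ω ∂P, prodBernoulli (lupuWeight fun y => g y ω) (percolatesAt x) = 0

/-- THE ANNEALED FORM used by route PercLupuEnvironment (`SolvedEndAnchor` (i) is `d = 3`,
`x = 0`): the annealed percolation probability `E[prodBernoulli (lupuWeight g) {|C(x)| = ∞}]`
vanishes (integral of an a.e.-zero function). [cite: Lupu2016, Prop. 5.5 (arXiv numbering)] -/
theorem Lupu2016_cableSignClustersBounded.integral_eq_zero (hL : Lupu2016_cableSignClustersBounded)
    {d : ℕ} (hd : 3 ≤ d) {Ω : Type} [MeasurableSpace Ω] (P : Measure Ω) [IsProbabilityMeasure P]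
    (g : Site d → Ω → ℝ) (hg : IsDiscreteGFF P g) (x : Site d) :
    ∫ ω, (prodBernoulli (lupuWeight fun y => g y ω)).real (percolatesAt x) ∂P = 0 := by
  refine integral_eq_zero_of_ae ?_
  filter_upwards [hL d hd Ω P g hg x] with ω hω
  simp [Measure.real, hω]

/-! ### Fact B: the excursion sets above every negative level percolate (`h̃_* = 0`) -/

/-- **Drewitz–Prévost–Rodriguez 2022, Cor. 3.3 (2) on `ℤ^d`, `d ≥ 3` (vertex trace); = DPR 2018
(1.10); Lupu 2016, proof of Thm 3.**  On a transient weighted graph without killing — here `ℤ^d`,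
`d ≥ 3`, unit conductances — for each `h > 0` and each vertex `x`, the excursion set
`{φ̃ ≥ -h}` of the cable-system GFF has an UNBOUNDED component containing `x` with positive
probability (so `h̃_* ≥ 0`, and `= 0` by Fact A).  Conditionally on the discrete field
`φ = φ̃|_{ℤ^d}` the cables on which `φ̃ > -h` are independent with probabilities
`lupuWeight (h + φ)` (DPR 2018 Lemma 2.1, (2.8); `{φ̃ ≥ -h}` and `{φ̃ > -h}` agree up to a null
event), so the statement reads: for every version `g` of the discrete GFF, the annealed probability
`E[prodBernoulli (lupuWeight (h + g)) {|C(x)| = ∞}]` is positive.  (`SolvedEndAnchor` (ii) of route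
PercLupuEnvironment is `d = 3`, `x = 0`.)
[cite: DrewitzPrevostRodriguez2021, Cor. 3.3 (2) (arXiv numbering)] -/
def Lupu2016_cableLevelSetsPercolate : Prop :=
  ∀ (d : ℕ), 3 ≤ d → ∀ (Ω : Type) [MeasurableSpace Ω] (P : Measure Ω) [IsProbabilityMeasure P]
    (g : Site d → Ω → ℝ), IsDiscreteGFF P g →
    ∀ h : ℝ, 0 < h → ∀ x : Site d,
      0 < ∫ ω, (prodBernoulli (lupuWeight fun y => h + g y ω)).real (percolatesAt x) ∂P

/-! ### Monotone comparison (used to move between levels and versions of the weights) -/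

/-- Raising the field raises every quenched probability of an increasing measurable event, in
particular of `{|C(x)| = ∞}` (Grimmett's coupling for coordinate-dependent parameters,
`prodBernoulli_real_mono_of_isUpperSet`, with `lupuWeight_mono`). [folklore] -/
theorem prodBernoulli_lupuWeight_percolatesAt_mono {ψ ψ' : Site d → ℝ} (h : ψ ≤ ψ') (x : Site d) :
    (prodBernoulli (lupuWeight ψ)).real (percolatesAt x) ≤
      (prodBernoulli (lupuWeight ψ')).real (percolatesAt x) :=
  prodBernoulli_real_mono_of_isUpperSet (lupuWeight_mono h) (isUpperSet_percolatesAt x)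
    (measurableSet_percolatesAt_holds x)

end Literature.Probability.LatticeModels

end
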